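import Summits.QuantumFields.BalabanUV.Beta.GAN24.CombBornLambdaDriftSup
import Summits.QuantumFields.BalabanUV.Beta.GAN24.CombBornLambdaFreshDrift

/-!
# The (III′) Λ-born RATE half at an1's SYM table, part 2 of 2 (END): **`hBd-Λ` FROM THE TWO CONTACT LETTERS ALONE**, `d = 3`, `2 ≤ Lc`, pin `cE = Lc^4`,
# `tabs.H = symHessFFAt (toSite rr) Lc` — the comb ∕ sym twin of leaf-06 g41's (E) `BornLambdaDrift.exists_hT_lam_three`, `BornLambdaDriftSup` §3–§4 and
# `BornLambdaDriftAssembly`: the UNDRESSED pairs (part 1 §2), the fresh-source drift (M.63 `exists_hXd_lam_three`) and the undressed lineage letter (M.76 `exists_hUg_three`)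
# are DISCHARGED; what remains are the Λ CONTACT letter `hCg-Λ` (lineage minus undressed lineage, `C·(k−i)^p·θ^{k−i}`) and the Λ CONTACT PAIR letter `hPc-Λ`
# (that contact lineage with one slot differenced, sup currency) — BOTH hypotheses of the END `exists_hBdevLam_three_of_contactPairs`

NOT IN PRINT — OUR BOOKKEEPING (road-P2 = `b2b-balaban-gan24-p2` gen 56, 2026-08-25; row G-an2-4 ∕ (CONV-C), the (α-0) chain at row D1's literal
OF RECORD (III′) `JsB12CombShSym`; [folklore] composition BY NAME — reindexing `(j, n) ↔ (k, i)`, the triangle inequality, `(m+1)^p s^m` bounded; 0 `def`, 0 cite,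
0 `def … : Prop`, 0 `sorry`).  Weight 0.  SOCKETS: the Λ CONTACT letter `hCg-Λ` and the Λ CONTACT PAIR letter `hPc-Λ` are OPEN at (III′) (the OWNER gan24-p1's
`PsiFace` ∕ conjugated-leg envelope words gate them); discharges NOTHING of (hS, hSall) by itself; NEVER «G-an2-4 closed» as (CONV-C); NOT D1, NOT BetaPertH,
NOT continuum, NOT Clay; NO campaign opened (an2 W-4) — typed while idle under R-2 (road-P2 MEMO M-gan24p2-g56-1, `gen56/S-CAMPAIGN-SIZING-g56.v0_7.md` §2(c)).

## Contents
§3 (`d = 3`; twins of `BornLambdaDrift.exists_hT_lam_three` and `BornLambdaDriftSup.exists_pairZero_lam_three` with leaf-02's (E) contact letter replaced by the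
HYPOTHESIS `hCg`, any log power `p`) `exists_hT_lam_three_of_contact`, `exists_pairZero_lam_three_of_contact`.
§4 (`d = 3`) `exists_hBdevLam_three_of_supPairs_of_contact` (twin of `BornLambdaDriftSup.exists_hBdevLam_three_of_supPairs`: `hCg` + sup pairs ⇒ `hBd-Λ`; `hB` by M.76's
`exists_hBLam_three_of_contact` through part 1 §3, the fresh drift by M.63, the top lineage by §3, then part 1 §1), and the END
**`exists_hBdevLam_three_of_contactPairs (hCg) (hPc) : ∃ cB θB δB, 0 ≤ cB ∧ 0 ≤ θB ∧ θB < 1 ∧ 0 < δB ∧ ∀ k j, LocStencil (U_{k+j} − U_k) (cB·θB^k) δB`**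
for `U_k = unitS (sfStep Lc k) (smStep 3 Lc k) (combBornOf Lc tabs cE 0 cΛ k)` (twin of `BornLambdaDriftAssembly.exists_hBdevLam_three_of_contactPairs`; the dressed
pair = undressed pair + contact pair pointwise, the pair `i = 0` by §3, exponent `p + q`).
-/

noncomputable section

open Finset
open scoped BigOperators
open Literature.MathematicalPhysics.QuantumFieldTheory
open Literature.MathematicalPhysics.QuantumFieldTheory.Balaban1983to89
open Literature.MathematicalPhysics.QuantumFieldTheory.Balaban1983to89.Beta
open ExpKernelCalculus (MKer)
open OneStepResolventKernel (Fib LocStencil)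
open AffineAveraging (box toSite)
open AveragingContoursRooted (ctr ctrOff)
open BalabanCompositeJets (respStep)
open StepJetData (locStencil_add)
open Summit.QuantumFields.BalabanUV.Beta.HessKerDressedUnits (unitS)
open Summit.QuantumFields.BalabanUV.Beta.SymCorrectorKernel (psiKS)
open Summit.QuantumFields.BalabanUV.Beta.SymmetrisedStepJets (SymTables)
open Summit.QuantumFields.BalabanUV.Beta.SymAveragingHessianCounts (symHessFFAt)
open Summit.QuantumFields.BalabanUV.Beta.GAN24.CombesThomas (sfStep smStep SupBound)
open Summit.QuantumFields.BalabanUV.Beta.GAN24.StencilSlotOfShapes (locStencil_mono')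
open Summit.QuantumFields.BalabanUV.Beta.GAN24.StencilSlotCauchyOfShapes (locStencil_sub)
open Summit.QuantumFields.BalabanUV.Beta.GAN24.Push4 (legComp IsFF)
open Summit.QuantumFields.BalabanUV.Beta.GAN24.Push4Iter (legChain)
open Summit.QuantumFields.BalabanUV.Beta.GAN24.Push3 (push₃)
open Summit.QuantumFields.BalabanUV.Beta.GAN24.RespStepBmDecompExact (respStepBmSeq)
open Summit.QuantumFields.BalabanUV.Beta.GAN24.BornLambdaDriftSup (locStencil_zero_iff_supBound locStencil_zero_of_locStencil)
open Summit.QuantumFields.BalabanUV.Beta.GAN24.CombBornLambdaDriftSup (exists_hBdevLam_of_supLetters exists_pairU_sup_three exists_contact_geometric_of_poly)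
open Summit.QuantumFields.BalabanUV.Beta.GAN24.CombWilsonSector (combBornOf)
open Summit.QuantumFields.BalabanUV.Beta.GAN24.CombBornSector (combFreshAt)
open Summit.QuantumFields.BalabanUV.Beta.GAN24.CombBornLambdaFreshDrift (exists_hXd_lam_three)
open Summit.QuantumFields.BalabanUV.Beta.GAN24.CombBornLambdaUndressedRow (exists_hUg_three exists_hBLam_three_of_contact)

namespace Summit.QuantumFields.BalabanUV.Beta.GAN24.CombBornLambdaDriftAssembly

/-! ## §3 `d = 3`: the top lineage and the pair `i = 0` from the undressed letter (M.76) and the CONTACT letter `hCg` (hypothesis, any log power `p`) -/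

section Contact

variable {Lc : ℕ} [NeZero Lc] (tabs : SymTables 3 Lc) (hHff : ∀ μ y, IsFF (tabs.H μ y))
include hHff

/-- NOT IN PRINT; OUR BOOKKEEPING (`d = 3`, `2 ≤ Lc`, pin `cE = Lc^4`; the twin of leaf-06 g41's `BornLambdaDrift.exists_hT_lam_three` with leaf-02's (E) contact letter
replaced by the HYPOTHESIS `hCg`).  **THE TOP LINEAGE IS GEOMETRIC WITH `p` LOGS**: the lineage born at the finest level observed at `k+1` (weight `(cE·Lc^8)^{k+1}`, the comb
chains `legChain (legComp Ψ ∘ respStepBmSeq (ctr) Lc) 0 k`) = undressed (M.76 `exists_hUg_three` at `i = 0`: `C·θ^{k+1}`) + contact (`hCg` at `i = 0`: `C·(k+1)^p·θ^{k+1}`)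
⇒ constant `CT·(k+1)^p·θT^{k+1}`, `θT = max` of the two rates. -/
theorem exists_hT_lam_three_of_contact (hLc : 2 ≤ Lc) {rr : Fin (3 + 1) → ℕ} (hrr : rr ∈ box (3 + 1) Lc) (hH : tabs.H = symHessFFAt (toSite rr) Lc)
    {cE : ℝ} (hcE : cE = (Lc : ℝ) ^ (3 + 1)) (cΛ : ℝ) {p : ℕ}
    (hCg : ∃ C θ δ : ℝ, 0 ≤ C ∧ 0 ≤ θ ∧ θ < 1 ∧ 0 < δ ∧ ∀ k i : ℕ, i < k →
      LocStencil (fun κ' u' => (cE * (Lc : ℝ) ^ (2 * (3 + 1))) ^ (k - i) •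
        (push₃ (legChain (fun j => legComp (fun α x κ u => psiKS (ctrOff (3 + 1) Lc) Lc u x (Sum.inl κ) (Sum.inl α)) (respStepBmSeq (d := 3) (ctr (3 + 1) Lc) Lc j)) i (k - 1 - i)) (legChain (fun j => legComp (fun α x κ u => psiKS (ctrOff (3 + 1) Lc) Lc u x (Sum.inl κ) (Sum.inl α)) (respStepBmSeq (d := 3) (ctr (3 + 1) Lc) Lc j)) i (k - 1 - i))
              (legChain (fun j => legComp (fun α x κ u => psiKS (ctrOff (3 + 1) Lc) Lc u x (Sum.inl κ) (Sum.inl α)) (respStepBmSeq (d := 3) (ctr (3 + 1) Lc) Lc j)) i (k - 1 - i))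
              (unitS (sfStep Lc i) (smStep 3 Lc i) (combFreshAt tabs 0 cΛ i)) κ' u'
          - push₃ (respStep (d := 3) (Lc ^ i) (Lc ^ k)) (respStep (d := 3) (Lc ^ i) (Lc ^ k)) (respStep (d := 3) (Lc ^ i) (Lc ^ k))
              (unitS (sfStep Lc i) (smStep 3 Lc i) (combFreshAt tabs 0 cΛ i)) κ' u')) (C * ((((k - i : ℕ) : ℝ)) ^ p * θ ^ (k - i))) δ) :
    ∃ CT θT δT : ℝ, 0 ≤ CT ∧ 0 ≤ θT ∧ θT < 1 ∧ 0 < δT ∧ ∀ k : ℕ,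
      LocStencil (fun κ' u' => (cE * (Lc : ℝ) ^ (2 * (3 + 1))) ^ (k + 1) •
        push₃ (legChain (fun j => legComp (fun α x κ u => psiKS (ctrOff (3 + 1) Lc) Lc u x (Sum.inl κ) (Sum.inl α)) (respStepBmSeq (d := 3) (ctr (3 + 1) Lc) Lc j)) 0 k) (legChain (fun j => legComp (fun α x κ u => psiKS (ctrOff (3 + 1) Lc) Lc u x (Sum.inl κ) (Sum.inl α)) (respStepBmSeq (d := 3) (ctr (3 + 1) Lc) Lc j)) 0 k)
              (legChain (fun j => legComp (fun α x κ u => psiKS (ctrOff (3 + 1) Lc) Lc u x (Sum.inl κ) (Sum.inl α)) (respStepBmSeq (d := 3) (ctr (3 + 1) Lc) Lc j)) 0 k)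
              (unitS (sfStep Lc 0) (smStep 3 Lc 0) (combFreshAt tabs 0 cΛ 0)) κ' u') (CT * ((((k + 1 : ℕ) : ℝ)) ^ p * θT ^ (k + 1))) δT := by
  obtain ⟨C₁, θ₁, δ₁, hC₁, hθ₁0, hθ₁1, hδ₁, hU⟩ := exists_hUg_three tabs hHff hLc hrr hH hcE cΛ
  obtain ⟨C₂, θ₂, δ₂, hC₂, hθ₂0, hθ₂1, hδ₂, hCg⟩ := hCg
  set θT : ℝ := max θ₁ θ₂ with hθT
  have hθT0 : 0 ≤ θT := le_max_of_le_left hθ₁0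
  have hθT1 : θT < 1 := max_lt hθ₁1 hθ₂1
  set δT : ℝ := min δ₁ δ₂ with hδT
  refine ⟨C₁ + C₂, θT, δT, by positivity, hθT0, hθT1, lt_min hδ₁ hδ₂, fun k => ?_⟩
  have h1 := hU (k + 1) 0 (Nat.zero_lt_succ k)
  have h2 := hCg (k + 1) 0 (Nat.zero_lt_succ k)
  simp only [Nat.sub_zero, Nat.add_sub_cancel, pow_zero] at h1 h2
  have e : (fun κ' u' => (cE * (Lc : ℝ) ^ (2 * (3 + 1))) ^ (k + 1) •
        push₃ (legChain (fun j => legComp (fun α x κ u => psiKS (ctrOff (3 + 1) Lc) Lc u x (Sum.inl κ) (Sum.inl α)) (respStepBmSeq (d := 3) (ctr (3 + 1) Lc) Lc j)) 0 k) (legChain (fun j => legComp (fun α x κ u => psiKS (ctrOff (3 + 1) Lc) Lc u x (Sum.inl κ) (Sum.inl α)) (respStepBmSeq (d := 3) (ctr (3 + 1) Lc) Lc j)) 0 k)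
              (legChain (fun j => legComp (fun α x κ u => psiKS (ctrOff (3 + 1) Lc) Lc u x (Sum.inl κ) (Sum.inl α)) (respStepBmSeq (d := 3) (ctr (3 + 1) Lc) Lc j)) 0 k)
              (unitS (sfStep Lc 0) (smStep 3 Lc 0) (combFreshAt tabs 0 cΛ 0)) κ' u')
      = (fun κ' u' => (fun κ' u' => (cE * (Lc : ℝ) ^ (2 * (3 + 1))) ^ (k + 1) •
            push₃ (respStep (d := 3) (Lc ^ 0) (Lc ^ (k + 1))) (respStep (d := 3) (Lc ^ 0) (Lc ^ (k + 1))) (respStep (d := 3) (Lc ^ 0) (Lc ^ (k + 1)))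
              (unitS (sfStep Lc 0) (smStep 3 Lc 0) (combFreshAt tabs 0 cΛ 0)) κ' u') κ' u'
          + (fun κ' u' => (cE * (Lc : ℝ) ^ (2 * (3 + 1))) ^ (k + 1) •
            (push₃ (legChain (fun j => legComp (fun α x κ u => psiKS (ctrOff (3 + 1) Lc) Lc u x (Sum.inl κ) (Sum.inl α)) (respStepBmSeq (d := 3) (ctr (3 + 1) Lc) Lc j)) 0 k) (legChain (fun j => legComp (fun α x κ u => psiKS (ctrOff (3 + 1) Lc) Lc u x (Sum.inl κ) (Sum.inl α)) (respStepBmSeq (d := 3) (ctr (3 + 1) Lc) Lc j)) 0 k)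
              (legChain (fun j => legComp (fun α x κ u => psiKS (ctrOff (3 + 1) Lc) Lc u x (Sum.inl κ) (Sum.inl α)) (respStepBmSeq (d := 3) (ctr (3 + 1) Lc) Lc j)) 0 k)
              (unitS (sfStep Lc 0) (smStep 3 Lc 0) (combFreshAt tabs 0 cΛ 0)) κ' u'
              - push₃ (respStep (d := 3) (Lc ^ 0) (Lc ^ (k + 1))) (respStep (d := 3) (Lc ^ 0) (Lc ^ (k + 1))) (respStep (d := 3) (Lc ^ 0) (Lc ^ (k + 1)))
              (unitS (sfStep Lc 0) (smStep 3 Lc 0) (combFreshAt tabs 0 cΛ 0)) κ' u')) κ' u') := by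
    funext κ' u'
    simp only [smul_sub, add_sub_cancel]
  rw [e]
  have h := locStencil_add (locStencil_mono' h1 le_rfl (min_le_left δ₁ δ₂)) (locStencil_mono' h2 le_rfl (min_le_right δ₁ δ₂))
  refine locStencil_mono' h ?_ le_rfl
  -- `C₁ θ₁^(k+1) + C₂ (k+1)^p θ₂^(k+1) ≤ (C₁ + C₂) (k+1)^p θT^(k+1)`
  have hk1 : (1 : ℝ) ≤ ((k + 1 : ℕ) : ℝ) := by exact_mod_cast Nat.succ_le_succ (Nat.zero_le k)
  have hX1 : (1 : ℝ) ≤ (((k + 1 : ℕ) : ℝ)) ^ p := one_le_pow₀ hk1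
  have hp1 : θ₁ ^ (k + 1) ≤ θT ^ (k + 1) := pow_le_pow_left₀ hθ₁0 (le_max_left _ _) _
  have hp2 : θ₂ ^ (k + 1) ≤ θT ^ (k + 1) := pow_le_pow_left₀ hθ₂0 (le_max_right _ _) _
  have hTk : 0 ≤ θT ^ (k + 1) := pow_nonneg hθT0 _
  have hA : C₁ * θ₁ ^ (k + 1) ≤ C₁ * ((((k + 1 : ℕ) : ℝ)) ^ p * θT ^ (k + 1)) :=
    mul_le_mul_of_nonneg_left (hp1.trans (le_mul_of_one_le_left hTk hX1)) hC₁
  have hB : C₂ * ((((k + 1 : ℕ) : ℝ)) ^ p * θ₂ ^ (k + 1)) ≤ C₂ * ((((k + 1 : ℕ) : ℝ)) ^ p * θT ^ (k + 1)) :=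
    mul_le_mul_of_nonneg_left (mul_le_mul_of_nonneg_left hp2 (by positivity)) hC₂
  have e2 : (C₁ + C₂) * ((((k + 1 : ℕ) : ℝ)) ^ p * θT ^ (k + 1)) =
      C₁ * ((((k + 1 : ℕ) : ℝ)) ^ p * θT ^ (k + 1)) + C₂ * ((((k + 1 : ℕ) : ℝ)) ^ p * θT ^ (k + 1)) := by ring
  rw [e2]
  exact add_le_add hA hB

/-- NOT IN PRINT; OUR BOOKKEEPING (`d = 3`, `2 ≤ Lc`, pin `cE = Lc^4`; the twin of leaf-06 g41's `BornLambdaDriftSup.exists_pairZero_lam_three` with leaf-02's (E) contact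
letter replaced by the HYPOTHESIS `hCg`).  **THE TOP-ALIGNED PAIR AT BIRTH LEVEL `0` NEEDS NO CAUCHY INPUT**: member `k+1`'s lineage born at `1` and member `k`'s born at
`0` (`k ≥ 1`) are EACH bounded by the lineage letters (M.76 `exists_hUg_three` + `hCg`, lengths `k`), so their difference is a local stencil family with constant
`C·k^p·Θ^k` — the `i = 0` instance of §1's `hP` (indices left raw: `k - 0`, `0 + 1`, `k - 1 - 0`). -/
theorem exists_pairZero_lam_three_of_contact (hLc : 2 ≤ Lc) {rr : Fin (3 + 1) → ℕ} (hrr : rr ∈ box (3 + 1) Lc) (hH : tabs.H = symHessFFAt (toSite rr) Lc)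
    {cE : ℝ} (hcE : cE = (Lc : ℝ) ^ (3 + 1)) (cΛ : ℝ) {p : ℕ}
    (hCg : ∃ C θ δ : ℝ, 0 ≤ C ∧ 0 ≤ θ ∧ θ < 1 ∧ 0 < δ ∧ ∀ k i : ℕ, i < k →
      LocStencil (fun κ' u' => (cE * (Lc : ℝ) ^ (2 * (3 + 1))) ^ (k - i) •
        (push₃ (legChain (fun j => legComp (fun α x κ u => psiKS (ctrOff (3 + 1) Lc) Lc u x (Sum.inl κ) (Sum.inl α)) (respStepBmSeq (d := 3) (ctr (3 + 1) Lc) Lc j)) i (k - 1 - i)) (legChain (fun j => legComp (fun α x κ u => psiKS (ctrOff (3 + 1) Lc) Lc u x (Sum.inl κ) (Sum.inl α)) (respStepBmSeq (d := 3) (ctr (3 + 1) Lc) Lc j)) i (k - 1 - i))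
              (legChain (fun j => legComp (fun α x κ u => psiKS (ctrOff (3 + 1) Lc) Lc u x (Sum.inl κ) (Sum.inl α)) (respStepBmSeq (d := 3) (ctr (3 + 1) Lc) Lc j)) i (k - 1 - i))
              (unitS (sfStep Lc i) (smStep 3 Lc i) (combFreshAt tabs 0 cΛ i)) κ' u'
          - push₃ (respStep (d := 3) (Lc ^ i) (Lc ^ k)) (respStep (d := 3) (Lc ^ i) (Lc ^ k)) (respStep (d := 3) (Lc ^ i) (Lc ^ k))
              (unitS (sfStep Lc i) (smStep 3 Lc i) (combFreshAt tabs 0 cΛ i)) κ' u')) (C * ((((k - i : ℕ) : ℝ)) ^ p * θ ^ (k - i))) δ) :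
    ∃ CP Θ δP : ℝ, 0 ≤ CP ∧ 0 ≤ Θ ∧ Θ < 1 ∧ 0 < δP ∧ ∀ k : ℕ, 0 < k →
      LocStencil
        ((fun κ' u' => (cE * (Lc : ℝ) ^ (2 * (3 + 1))) ^ (k - 0) •
            push₃ (legChain (fun j => legComp (fun α x κ u => psiKS (ctrOff (3 + 1) Lc) Lc u x (Sum.inl κ) (Sum.inl α)) (respStepBmSeq (d := 3) (ctr (3 + 1) Lc) Lc j)) (0 + 1) (k - 1 - 0)) (legChain (fun j => legComp (fun α x κ u => psiKS (ctrOff (3 + 1) Lc) Lc u x (Sum.inl κ) (Sum.inl α)) (respStepBmSeq (d := 3) (ctr (3 + 1) Lc) Lc j)) (0 + 1) (k - 1 - 0))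
              (legChain (fun j => legComp (fun α x κ u => psiKS (ctrOff (3 + 1) Lc) Lc u x (Sum.inl κ) (Sum.inl α)) (respStepBmSeq (d := 3) (ctr (3 + 1) Lc) Lc j)) (0 + 1) (k - 1 - 0))
              (unitS (sfStep Lc (0 + 1)) (smStep 3 Lc (0 + 1)) (combFreshAt tabs 0 cΛ (0 + 1))) κ' u')
          - fun κ' u' => (cE * (Lc : ℝ) ^ (2 * (3 + 1))) ^ (k - 0) •
            push₃ (legChain (fun j => legComp (fun α x κ u => psiKS (ctrOff (3 + 1) Lc) Lc u x (Sum.inl κ) (Sum.inl α)) (respStepBmSeq (d := 3) (ctr (3 + 1) Lc) Lc j)) 0 (k - 1 - 0)) (legChain (fun j => legComp (fun α x κ u => psiKS (ctrOff (3 + 1) Lc) Lc u x (Sum.inl κ) (Sum.inl α)) (respStepBmSeq (d := 3) (ctr (3 + 1) Lc) Lc j)) 0 (k - 1 - 0))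
              (legChain (fun j => legComp (fun α x κ u => psiKS (ctrOff (3 + 1) Lc) Lc u x (Sum.inl κ) (Sum.inl α)) (respStepBmSeq (d := 3) (ctr (3 + 1) Lc) Lc j)) 0 (k - 1 - 0))
              (unitS (sfStep Lc 0) (smStep 3 Lc 0) (combFreshAt tabs 0 cΛ 0)) κ' u')
        (CP * ((((k - 0 : ℕ) : ℝ)) ^ p * Θ ^ k)) δP := by
  obtain ⟨C₁, θ₁, δ₁, hC₁, hθ₁0, hθ₁1, hδ₁, hU⟩ := exists_hUg_three tabs hHff hLc hrr hH hcE cΛ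
  obtain ⟨C₂, θ₂, δ₂, hC₂, hθ₂0, hθ₂1, hδ₂, hCg⟩ := hCg
  set Θ : ℝ := max θ₁ θ₂ with hΘ
  have hΘ0 : 0 ≤ Θ := le_max_of_le_left hθ₁0
  have hΘ1 : Θ < 1 := max_lt hθ₁1 hθ₂1
  refine ⟨C₁ + C₂ + (C₁ + C₂), Θ, min δ₁ δ₂, by positivity, hΘ0, hΘ1, lt_min hδ₁ hδ₂, fun k hk => ?_⟩
  -- a lineage = undressed + contact, as `LocStencil` families with the two letters added
  have hmem : ∀ i n : ℕ, i < n → LocStencil (fun κ' u' => (cE * (Lc : ℝ) ^ (2 * (3 + 1))) ^ (n - i) •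
      push₃ (legChain (fun j => legComp (fun α x κ u => psiKS (ctrOff (3 + 1) Lc) Lc u x (Sum.inl κ) (Sum.inl α)) (respStepBmSeq (d := 3) (ctr (3 + 1) Lc) Lc j)) i (n - 1 - i)) (legChain (fun j => legComp (fun α x κ u => psiKS (ctrOff (3 + 1) Lc) Lc u x (Sum.inl κ) (Sum.inl α)) (respStepBmSeq (d := 3) (ctr (3 + 1) Lc) Lc j)) i (n - 1 - i))
              (legChain (fun j => legComp (fun α x κ u => psiKS (ctrOff (3 + 1) Lc) Lc u x (Sum.inl κ) (Sum.inl α)) (respStepBmSeq (d := 3) (ctr (3 + 1) Lc) Lc j)) i (n - 1 - i))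
              (unitS (sfStep Lc i) (smStep 3 Lc i) (combFreshAt tabs 0 cΛ i)) κ' u')
      (C₁ * θ₁ ^ (n - i) + C₂ * ((((n - i : ℕ) : ℝ)) ^ p * θ₂ ^ (n - i))) (min δ₁ δ₂) := by
    intro i n hin
    have h1 := locStencil_mono' (hU n i hin) le_rfl (min_le_left δ₁ δ₂)
    have h2 := locStencil_mono' (hCg n i hin) le_rfl (min_le_right δ₁ δ₂)
    have h := locStencil_add h1 h2
    refine locStencil_mono' (S := fun κ' u' => (cE * (Lc : ℝ) ^ (2 * (3 + 1))) ^ (n - i) •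
      push₃ (legChain (fun j => legComp (fun α x κ u => psiKS (ctrOff (3 + 1) Lc) Lc u x (Sum.inl κ) (Sum.inl α)) (respStepBmSeq (d := 3) (ctr (3 + 1) Lc) Lc j)) i (n - 1 - i)) (legChain (fun j => legComp (fun α x κ u => psiKS (ctrOff (3 + 1) Lc) Lc u x (Sum.inl κ) (Sum.inl α)) (respStepBmSeq (d := 3) (ctr (3 + 1) Lc) Lc j)) i (n - 1 - i))
              (legChain (fun j => legComp (fun α x κ u => psiKS (ctrOff (3 + 1) Lc) Lc u x (Sum.inl κ) (Sum.inl α)) (respStepBmSeq (d := 3) (ctr (3 + 1) Lc) Lc j)) i (n - 1 - i))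
              (unitS (sfStep Lc i) (smStep 3 Lc i) (combFreshAt tabs 0 cΛ i)) κ' u') ?_ le_rfl le_rfl
    have e : (fun κ' u' => (cE * (Lc : ℝ) ^ (2 * (3 + 1))) ^ (n - i) •
        push₃ (legChain (fun j => legComp (fun α x κ u => psiKS (ctrOff (3 + 1) Lc) Lc u x (Sum.inl κ) (Sum.inl α)) (respStepBmSeq (d := 3) (ctr (3 + 1) Lc) Lc j)) i (n - 1 - i)) (legChain (fun j => legComp (fun α x κ u => psiKS (ctrOff (3 + 1) Lc) Lc u x (Sum.inl κ) (Sum.inl α)) (respStepBmSeq (d := 3) (ctr (3 + 1) Lc) Lc j)) i (n - 1 - i))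
              (legChain (fun j => legComp (fun α x κ u => psiKS (ctrOff (3 + 1) Lc) Lc u x (Sum.inl κ) (Sum.inl α)) (respStepBmSeq (d := 3) (ctr (3 + 1) Lc) Lc j)) i (n - 1 - i))
              (unitS (sfStep Lc i) (smStep 3 Lc i) (combFreshAt tabs 0 cΛ i)) κ' u')
        = fun κ' u => (fun κ' u' => (cE * (Lc : ℝ) ^ (2 * (3 + 1))) ^ (n - i) •
            push₃ (respStep (d := 3) (Lc ^ i) (Lc ^ n)) (respStep (d := 3) (Lc ^ i) (Lc ^ n)) (respStep (d := 3) (Lc ^ i) (Lc ^ n))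
              (unitS (sfStep Lc i) (smStep 3 Lc i) (combFreshAt tabs 0 cΛ i)) κ' u') κ' u
          + (fun κ' u' => (cE * (Lc : ℝ) ^ (2 * (3 + 1))) ^ (n - i) •
            (push₃ (legChain (fun j => legComp (fun α x κ u => psiKS (ctrOff (3 + 1) Lc) Lc u x (Sum.inl κ) (Sum.inl α)) (respStepBmSeq (d := 3) (ctr (3 + 1) Lc) Lc j)) i (n - 1 - i)) (legChain (fun j => legComp (fun α x κ u => psiKS (ctrOff (3 + 1) Lc) Lc u x (Sum.inl κ) (Sum.inl α)) (respStepBmSeq (d := 3) (ctr (3 + 1) Lc) Lc j)) i (n - 1 - i))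
              (legChain (fun j => legComp (fun α x κ u => psiKS (ctrOff (3 + 1) Lc) Lc u x (Sum.inl κ) (Sum.inl α)) (respStepBmSeq (d := 3) (ctr (3 + 1) Lc) Lc j)) i (n - 1 - i))
              (unitS (sfStep Lc i) (smStep 3 Lc i) (combFreshAt tabs 0 cΛ i)) κ' u'
              - push₃ (respStep (d := 3) (Lc ^ i) (Lc ^ n)) (respStep (d := 3) (Lc ^ i) (Lc ^ n)) (respStep (d := 3) (Lc ^ i) (Lc ^ n))
              (unitS (sfStep Lc i) (smStep 3 Lc i) (combFreshAt tabs 0 cΛ i)) κ' u')) κ' u := by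
      funext κ' u'
      simp only [smul_sub, add_sub_cancel]
    rw [e]
    exact h
  have ha := hmem 1 (k + 1) (by omega)
  have hb := hmem 0 k hk
  simp only [Nat.add_sub_cancel, Nat.sub_zero] at ha hb
  simp only [Nat.sub_zero, Nat.zero_add]
  have hab := locStencil_sub ha hb
  refine locStencil_mono' hab ?_ le_rfl
  -- `(C₁ θ₁^k + C₂ k^p θ₂^k) + (C₁ θ₁^k + C₂ k^p θ₂^k) ≤ (C₁ + C₂ + (C₁ + C₂))·k^p·Θ^k` for `k ≥ 1`
  have hk1 : (1 : ℝ) ≤ (k : ℝ) := by exact_mod_cast hk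
  have hX1 : (1 : ℝ) ≤ (k : ℝ) ^ p := one_le_pow₀ hk1
  have hp1 : θ₁ ^ k ≤ Θ ^ k := pow_le_pow_left₀ hθ₁0 (le_max_left _ _) _
  have hp2 : θ₂ ^ k ≤ Θ ^ k := pow_le_pow_left₀ hθ₂0 (le_max_right _ _) _
  have hTk : 0 ≤ Θ ^ k := pow_nonneg hΘ0 _
  have hA : C₁ * θ₁ ^ k ≤ C₁ * ((k : ℝ) ^ p * Θ ^ k) :=
    mul_le_mul_of_nonneg_left (hp1.trans (le_mul_of_one_le_left hTk hX1)) hC₁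
  have hB : C₂ * ((k : ℝ) ^ p * θ₂ ^ k) ≤ C₂ * ((k : ℝ) ^ p * Θ ^ k) :=
    mul_le_mul_of_nonneg_left (mul_le_mul_of_nonneg_left hp2 (by positivity)) hC₂
  have e2 : (C₁ + C₂ + (C₁ + C₂)) * ((k : ℝ) ^ p * Θ ^ k) =
      (C₁ * ((k : ℝ) ^ p * Θ ^ k) + C₂ * ((k : ℝ) ^ p * Θ ^ k)) + (C₁ * ((k : ℝ) ^ p * Θ ^ k) + C₂ * ((k : ℝ) ^ p * Θ ^ k)) := by ring
  rw [e2]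
  exact add_le_add (add_le_add hA hB) (add_le_add hA hB)

end Contact

/-! ## §4 `d = 3`: `hBd-Λ` at the sym table from the contact letter and the top-aligned pair letters; the END from the two CONTACT letters -/

section Three

variable {Lc : ℕ} [NeZero Lc] (tabs : SymTables 3 Lc) (hHff : ∀ μ y, IsFF (tabs.H μ y))
include hHff

/-- NOT IN PRINT; OUR PROOF ATTEMPT — A SOCKET (`d = 3`, `2 ≤ Lc`, pin `cE = Lc^4`, `tabs.H = symHessFFAt (toSite rr) Lc`; the twin of leaf-06 g41's
`BornLambdaDriftSup.exists_hBdevLam_three_of_supPairs` with the (E) row and top letters replaced by M.76 + `hCg`).  **`hBd-Λ` OF THE (III′) FAMILY FROM THE CONTACT LETTER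
AND THE TOP-ALIGNED PAIR LETTERS IN SUP CURRENCY**: `hB` by M.76's `exists_hBLam_three_of_contact` (the poly letter made geometric, §3), the fresh drift by M.63's
`exists_hXd_lam_three`, the top lineage by §3 (decay forgotten), then §1. -/
theorem exists_hBdevLam_three_of_supPairs_of_contact (hLc : 2 ≤ Lc) {rr : Fin (3 + 1) → ℕ} (hrr : rr ∈ box (3 + 1) Lc)
    (hH : tabs.H = symHessFFAt (toSite rr) Lc) {cE : ℝ} (hcE : cE = (Lc : ℝ) ^ (3 + 1)) (cΛ : ℝ) {p q : ℕ}
    (hCg : ∃ C θ δ : ℝ, 0 ≤ C ∧ 0 ≤ θ ∧ θ < 1 ∧ 0 < δ ∧ ∀ k i : ℕ, i < k →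
      LocStencil (fun κ' u' => (cE * (Lc : ℝ) ^ (2 * (3 + 1))) ^ (k - i) •
        (push₃ (legChain (fun j => legComp (fun α x κ u => psiKS (ctrOff (3 + 1) Lc) Lc u x (Sum.inl κ) (Sum.inl α)) (respStepBmSeq (d := 3) (ctr (3 + 1) Lc) Lc j)) i (k - 1 - i)) (legChain (fun j => legComp (fun α x κ u => psiKS (ctrOff (3 + 1) Lc) Lc u x (Sum.inl κ) (Sum.inl α)) (respStepBmSeq (d := 3) (ctr (3 + 1) Lc) Lc j)) i (k - 1 - i))
              (legChain (fun j => legComp (fun α x κ u => psiKS (ctrOff (3 + 1) Lc) Lc u x (Sum.inl κ) (Sum.inl α)) (respStepBmSeq (d := 3) (ctr (3 + 1) Lc) Lc j)) i (k - 1 - i))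
              (unitS (sfStep Lc i) (smStep 3 Lc i) (combFreshAt tabs 0 cΛ i)) κ' u'
          - push₃ (respStep (d := 3) (Lc ^ i) (Lc ^ k)) (respStep (d := 3) (Lc ^ i) (Lc ^ k)) (respStep (d := 3) (Lc ^ i) (Lc ^ k))
              (unitS (sfStep Lc i) (smStep 3 Lc i) (combFreshAt tabs 0 cΛ i)) κ' u')) (C * ((((k - i : ℕ) : ℝ)) ^ p * θ ^ (k - i))) δ)
    (hP : ∃ CP Θ : ℝ, 0 ≤ CP ∧ 0 ≤ Θ ∧ Θ < 1 ∧ ∀ k i : ℕ, i < k → ∀ κ u,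
      SupBound
        (((fun κ' u' => (cE * (Lc : ℝ) ^ (2 * (3 + 1))) ^ (k - i) •
            push₃ (legChain (fun j => legComp (fun α x κ u => psiKS (ctrOff (3 + 1) Lc) Lc u x (Sum.inl κ) (Sum.inl α)) (respStepBmSeq (d := 3) (ctr (3 + 1) Lc) Lc j)) (i + 1) (k - 1 - i)) (legChain (fun j => legComp (fun α x κ u => psiKS (ctrOff (3 + 1) Lc) Lc u x (Sum.inl κ) (Sum.inl α)) (respStepBmSeq (d := 3) (ctr (3 + 1) Lc) Lc j)) (i + 1) (k - 1 - i))
              (legChain (fun j => legComp (fun α x κ u => psiKS (ctrOff (3 + 1) Lc) Lc u x (Sum.inl κ) (Sum.inl α)) (respStepBmSeq (d := 3) (ctr (3 + 1) Lc) Lc j)) (i + 1) (k - 1 - i))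
              (unitS (sfStep Lc (i + 1)) (smStep 3 Lc (i + 1)) (combFreshAt tabs 0 cΛ (i + 1))) κ' u')
          - fun κ' u' => (cE * (Lc : ℝ) ^ (2 * (3 + 1))) ^ (k - i) •
            push₃ (legChain (fun j => legComp (fun α x κ u => psiKS (ctrOff (3 + 1) Lc) Lc u x (Sum.inl κ) (Sum.inl α)) (respStepBmSeq (d := 3) (ctr (3 + 1) Lc) Lc j)) i (k - 1 - i)) (legChain (fun j => legComp (fun α x κ u => psiKS (ctrOff (3 + 1) Lc) Lc u x (Sum.inl κ) (Sum.inl α)) (respStepBmSeq (d := 3) (ctr (3 + 1) Lc) Lc j)) i (k - 1 - i))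
              (legChain (fun j => legComp (fun α x κ u => psiKS (ctrOff (3 + 1) Lc) Lc u x (Sum.inl κ) (Sum.inl α)) (respStepBmSeq (d := 3) (ctr (3 + 1) Lc) Lc j)) i (k - 1 - i))
              (unitS (sfStep Lc i) (smStep 3 Lc i) (combFreshAt tabs 0 cΛ i)) κ' u') κ u)
        (CP * ((((k - i : ℕ) : ℝ)) ^ q * Θ ^ k))) :
    ∃ cB θB δB : ℝ, 0 ≤ cB ∧ 0 ≤ θB ∧ θB < 1 ∧ 0 < δB ∧ ∀ k j : ℕ,
      LocStencil (unitS (sfStep Lc (k + j)) (smStep 3 Lc (k + j)) (combBornOf Lc tabs cE 0 cΛ (k + j))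
        - unitS (sfStep Lc k) (smStep 3 Lc k) (combBornOf Lc tabs cE 0 cΛ k)) (cB * θB ^ k) δB := by
  obtain ⟨CF, θF, δF, hCF, hθF0, hθF1, hδF, hXd⟩ := exists_hXd_lam_three tabs hHff hLc cΛ
  obtain ⟨CT, θT, δT, hCT, hθT0, hθT1, hδT, hT⟩ := exists_hT_lam_three_of_contact tabs hHff hLc hrr hH hcE cΛ hCg
  refine exists_hBdevLam_of_supLetters (d := 3) tabs hHff (p := p) cE cΛ
    (exists_hBLam_three_of_contact tabs hHff hLc hrr hH hcE cΛ (exists_contact_geometric_of_poly hCg))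
    ⟨CF, θF, hCF, hθF0, hθF1, fun k => locStencil_zero_iff_supBound.1 (locStencil_zero_of_locStencil (hXd k) hδF.le)⟩
    ⟨CT, θT, hCT, hθT0, hθT1, fun k => locStencil_zero_iff_supBound.1 (locStencil_zero_of_locStencil (hT k) hδT.le)⟩ hP

/-- NOT IN PRINT; OUR PROOF ATTEMPT — A SOCKET, THE END (`d = 3`, `2 ≤ Lc`, pin `cE = Lc^4`, `tabs.H = symHessFFAt (toSite rr) Lc`; the twin of leaf-06 g41's
`BornLambdaDriftAssembly.exists_hBdevLam_three_of_contactPairs`).  **THE RATE HALF `hBd-Λ` OF THE (III′) Λ-BORN ROW FROM THE TWO CONTACT LETTERS ALONE**: GIVEN the Λ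
contact letter `hCg` (every lineage minus its undressed lineage: `C·(k−i)^p·θ^{k−i}`, one locality rate) and the Λ contact PAIR letter `hPc` (births `i ≥ 1`: the
contact lineage of member `k+1` born at `i+1` minus that of member `k` born at `i`, `CPc·(k−i)^q·Θc^k` entrywise, NO decay asked), the unit tables of
`combBornOf Lc tabs cE 0 cΛ` obey the all-scales Cauchy letter `LocStencil (U_{k+j} − U_k) (cB·θB^k) δB` with ONE `cB`, ONE `θB < 1`, ONE `δB > 0`: the dressed
pair = undressed pair (§2, UNCONDITIONAL) + contact pair pointwise, the pair `i = 0` by §3, then §4's socket with exponent `p + q`.  Both hypotheses are OPEN at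
(III′); NOT hSdev of the comb family (needs the Wilson sector's rate and the V half); NEVER «G-an2-4 closed». -/
theorem exists_hBdevLam_three_of_contactPairs (hLc : 2 ≤ Lc) {rr : Fin (3 + 1) → ℕ} (hrr : rr ∈ box (3 + 1) Lc)
    (hH : tabs.H = symHessFFAt (toSite rr) Lc) {cE : ℝ} (hcE : cE = (Lc : ℝ) ^ (3 + 1)) (cΛ : ℝ) {p q : ℕ}
    (hCg : ∃ C θ δ : ℝ, 0 ≤ C ∧ 0 ≤ θ ∧ θ < 1 ∧ 0 < δ ∧ ∀ k i : ℕ, i < k →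
      LocStencil (fun κ' u' => (cE * (Lc : ℝ) ^ (2 * (3 + 1))) ^ (k - i) •
        (push₃ (legChain (fun j => legComp (fun α x κ u => psiKS (ctrOff (3 + 1) Lc) Lc u x (Sum.inl κ) (Sum.inl α)) (respStepBmSeq (d := 3) (ctr (3 + 1) Lc) Lc j)) i (k - 1 - i)) (legChain (fun j => legComp (fun α x κ u => psiKS (ctrOff (3 + 1) Lc) Lc u x (Sum.inl κ) (Sum.inl α)) (respStepBmSeq (d := 3) (ctr (3 + 1) Lc) Lc j)) i (k - 1 - i))
              (legChain (fun j => legComp (fun α x κ u => psiKS (ctrOff (3 + 1) Lc) Lc u x (Sum.inl κ) (Sum.inl α)) (respStepBmSeq (d := 3) (ctr (3 + 1) Lc) Lc j)) i (k - 1 - i))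
              (unitS (sfStep Lc i) (smStep 3 Lc i) (combFreshAt tabs 0 cΛ i)) κ' u'
          - push₃ (respStep (d := 3) (Lc ^ i) (Lc ^ k)) (respStep (d := 3) (Lc ^ i) (Lc ^ k)) (respStep (d := 3) (Lc ^ i) (Lc ^ k))
              (unitS (sfStep Lc i) (smStep 3 Lc i) (combFreshAt tabs 0 cΛ i)) κ' u')) (C * ((((k - i : ℕ) : ℝ)) ^ p * θ ^ (k - i))) δ)
    (hPc : ∃ CPc Θc : ℝ, 0 ≤ CPc ∧ 0 ≤ Θc ∧ Θc < 1 ∧ ∀ k i : ℕ, 1 ≤ i → i < k → ∀ κ u,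
      SupBound
        (((fun κ' u' => (cE * (Lc : ℝ) ^ (2 * (3 + 1))) ^ (k - i) •
            (push₃ (legChain (fun j => legComp (fun α x κ u => psiKS (ctrOff (3 + 1) Lc) Lc u x (Sum.inl κ) (Sum.inl α)) (respStepBmSeq (d := 3) (ctr (3 + 1) Lc) Lc j)) (i + 1) (k - 1 - i)) (legChain (fun j => legComp (fun α x κ u => psiKS (ctrOff (3 + 1) Lc) Lc u x (Sum.inl κ) (Sum.inl α)) (respStepBmSeq (d := 3) (ctr (3 + 1) Lc) Lc j)) (i + 1) (k - 1 - i))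
              (legChain (fun j => legComp (fun α x κ u => psiKS (ctrOff (3 + 1) Lc) Lc u x (Sum.inl κ) (Sum.inl α)) (respStepBmSeq (d := 3) (ctr (3 + 1) Lc) Lc j)) (i + 1) (k - 1 - i))
              (unitS (sfStep Lc (i + 1)) (smStep 3 Lc (i + 1)) (combFreshAt tabs 0 cΛ (i + 1))) κ' u'
              - push₃ (respStep (d := 3) (Lc ^ (i + 1)) (Lc ^ (k + 1))) (respStep (d := 3) (Lc ^ (i + 1)) (Lc ^ (k + 1))) (respStep (d := 3) (Lc ^ (i + 1)) (Lc ^ (k + 1)))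
              (unitS (sfStep Lc (i + 1)) (smStep 3 Lc (i + 1)) (combFreshAt tabs 0 cΛ (i + 1))) κ' u'))
          - fun κ' u' => (cE * (Lc : ℝ) ^ (2 * (3 + 1))) ^ (k - i) •
            (push₃ (legChain (fun j => legComp (fun α x κ u => psiKS (ctrOff (3 + 1) Lc) Lc u x (Sum.inl κ) (Sum.inl α)) (respStepBmSeq (d := 3) (ctr (3 + 1) Lc) Lc j)) i (k - 1 - i)) (legChain (fun j => legComp (fun α x κ u => psiKS (ctrOff (3 + 1) Lc) Lc u x (Sum.inl κ) (Sum.inl α)) (respStepBmSeq (d := 3) (ctr (3 + 1) Lc) Lc j)) i (k - 1 - i))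
              (legChain (fun j => legComp (fun α x κ u => psiKS (ctrOff (3 + 1) Lc) Lc u x (Sum.inl κ) (Sum.inl α)) (respStepBmSeq (d := 3) (ctr (3 + 1) Lc) Lc j)) i (k - 1 - i))
              (unitS (sfStep Lc i) (smStep 3 Lc i) (combFreshAt tabs 0 cΛ i)) κ' u'
              - push₃ (respStep (d := 3) (Lc ^ i) (Lc ^ k)) (respStep (d := 3) (Lc ^ i) (Lc ^ k)) (respStep (d := 3) (Lc ^ i) (Lc ^ k))
              (unitS (sfStep Lc i) (smStep 3 Lc i) (combFreshAt tabs 0 cΛ i)) κ' u')) κ u)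
        (CPc * ((((k - i : ℕ) : ℝ)) ^ q * Θc ^ k))) :
    ∃ cB θB δB : ℝ, 0 ≤ cB ∧ 0 ≤ θB ∧ θB < 1 ∧ 0 < δB ∧ ∀ k j : ℕ,
      LocStencil (unitS (sfStep Lc (k + j)) (smStep 3 Lc (k + j)) (combBornOf Lc tabs cE 0 cΛ (k + j))
        - unitS (sfStep Lc k) (smStep 3 Lc k) (combBornOf Lc tabs cE 0 cΛ k)) (cB * θB ^ k) δB := by
  obtain ⟨CPc, Θc, hCPc, hΘc0, hΘc1, hPc⟩ := hPc
  obtain ⟨CU, ΘU, hCU, hΘU0, hΘU1, hU⟩ := exists_pairU_sup_three tabs hHff hLc hrr hH hcE cΛ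
  obtain ⟨C₀, Θ₀, δ₀, hC₀, hΘ₀0, hΘ₀1, hδ₀, hZ⟩ := exists_pairZero_lam_three_of_contact tabs hHff hLc hrr hH hcE cΛ hCg
  -- one rate
  set Θ : ℝ := max (max ΘU Θc) Θ₀ with hΘ
  have hΘ0 : 0 ≤ Θ := hΘ₀0.trans (le_max_right _ _)
  have hΘ1 : Θ < 1 := max_lt (max_lt hΘU1 hΘc1) hΘ₀1
  have hUΘ : ΘU ≤ Θ := (le_max_left _ _).trans (le_max_left _ _)
  have hcΘ : Θc ≤ Θ := (le_max_right _ _).trans (le_max_left _ _)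
  have h0Θ : Θ₀ ≤ Θ := le_max_right _ _
  refine exists_hBdevLam_three_of_supPairs_of_contact tabs hHff hLc hrr hH hcE cΛ (p := p) (q := p + q) hCg
    ⟨CU / ΘU + CPc + C₀, Θ, by positivity, hΘ0, hΘ1, fun k i hik κ u x z a b => ?_⟩
  have hki : 1 ≤ ((k - i : ℕ) : ℝ) := by exact_mod_cast Nat.succ_le_of_lt (Nat.sub_pos_of_lt hik)
  have hkiq : ((k - i : ℕ) : ℝ) ^ q ≤ ((k - i : ℕ) : ℝ) ^ (p + q) := pow_le_pow_right₀ hki (by omega)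
  have hkip : ((k - i : ℕ) : ℝ) ^ p ≤ ((k - i : ℕ) : ℝ) ^ (p + q) := pow_le_pow_right₀ hki (by omega)
  have hkiq1 : 1 ≤ ((k - i : ℕ) : ℝ) ^ (p + q) := one_le_pow₀ hki
  have hΘk : 0 ≤ Θ ^ k := pow_nonneg hΘ0 k
  rcases Nat.eq_zero_or_pos i with hi | hi
  · -- the pair `i = 0`: both members by the lineage letters (§3), decay forgotten
    subst hi
    have h := (locStencil_zero_iff_supBound.1 (locStencil_zero_of_locStencil (hZ k hik) hδ₀.le)) κ u x z a b
    refine h.trans ?_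
    have hp : Θ₀ ^ k ≤ Θ ^ k := pow_le_pow_left₀ hΘ₀0 h0Θ k
    calc C₀ * ((((k - 0 : ℕ) : ℝ)) ^ p * Θ₀ ^ k) ≤ C₀ * ((((k - 0 : ℕ) : ℝ)) ^ (p + q) * Θ ^ k) := by gcongr
      _ ≤ (CU / ΘU + CPc + C₀) * ((((k - 0 : ℕ) : ℝ)) ^ (p + q) * Θ ^ k) := by
          have : C₀ ≤ CU / ΘU + CPc + C₀ := by have := div_nonneg hCU hΘU0.le; linarith
          exact mul_le_mul_of_nonneg_right this (by positivity)
  · -- births `i ≥ 1`: dressed pair = undressed pair + contact pair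
    obtain ⟨j, rfl⟩ : ∃ j, i = j + 1 := ⟨i - 1, by omega⟩
    obtain ⟨n, rfl⟩ : ∃ n, k = j + n + 1 + 1 := ⟨k - j - 2, by omega⟩
    have hC := hPc (j + n + 1 + 1) (j + 1) hi hik κ u x z a b
    have hUp := hU j n κ u x z a b
    dsimp only at hC hUp ⊢
    have ek : j + n + 1 + 1 - (j + 1) = n + 1 := by omega
    have el : j + n + 1 + 1 - 1 - (j + 1) = n := by omega
    have em : j + 1 + n + 1 + 1 = j + n + 1 + 1 + 1 := by omega
    rw [em] at hUp
    rw [ek] at hki hkiq hkip hkiq1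
    simp only [ek, el] at hC ⊢
    simp only [Pi.sub_apply, Pi.smul_apply, smul_eq_mul] at hC hUp ⊢
    rw [mul_sub, mul_sub] at hC
    -- `|a − c| ≤ |b − d| + |(a − b) − (c − d)|`
    have h4 : ∀ a' b' c' d' : ℝ, |a' - c'| ≤ |b' - d'| + |a' - b' - (c' - d')| := fun a' b' c' d' => by
      have e : a' - c' = (b' - d') + (a' - b' - (c' - d')) := by ring
      rw [e]; exact abs_add_le _ _
    refine (h4 _ _ _ _).trans ((add_le_add hUp hC).trans ?_)
    -- the two letters against the common constant
    set X : ℝ := (((n + 1 : ℕ) : ℝ)) ^ (p + q) * Θ ^ (j + n + 1 + 1) with hX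
    have hX0 : 0 ≤ X := by positivity
    have hUb : CU * ΘU ^ (j + n + 1) ≤ CU / ΘU * X := by
      have e : CU * ΘU ^ (j + n + 1) = CU / ΘU * ΘU ^ (j + n + 1 + 1) := by
        rw [pow_succ]; field_simp; ring
      rw [e, hX]
      refine mul_le_mul_of_nonneg_left ?_ (div_nonneg hCU hΘU0.le)
      calc ΘU ^ (j + n + 1 + 1) ≤ Θ ^ (j + n + 1 + 1) := pow_le_pow_left₀ hΘU0.le hUΘ _
        _ = 1 * Θ ^ (j + n + 1 + 1) := (one_mul _).symm
        _ ≤ (((n + 1 : ℕ) : ℝ)) ^ (p + q) * Θ ^ (j + n + 1 + 1) := mul_le_mul_of_nonneg_right hkiq1 (pow_nonneg hΘ0 _)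
    have hCb : CPc * ((((n + 1 : ℕ) : ℝ)) ^ q * Θc ^ (j + n + 1 + 1)) ≤ CPc * X := by
      rw [hX]
      refine mul_le_mul_of_nonneg_left ?_ hCPc
      have hp : Θc ^ (j + n + 1 + 1) ≤ Θ ^ (j + n + 1 + 1) := pow_le_pow_left₀ hΘc0 hcΘ _
      exact mul_le_mul hkiq hp (pow_nonneg hΘc0 _) (by positivity)
    have hC0b : 0 ≤ C₀ * X := mul_nonneg hC₀ hX0
    have e : (CU / ΘU + CPc + C₀) * X = CU / ΘU * X + CPc * X + C₀ * X := by ring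
    rw [e]
    linarith

end Three

end Summit.QuantumFields.BalabanUV.Beta.GAN24.CombBornLambdaDriftAssembly

end
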